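import Mathlib
import HarnessLib
import Summits.ResolutionOfSingularities.ResolutionOfSingularities.Theorems.WildQuotientsWildQuotientResolutionS1aKillGlue
import Summits.ResolutionOfSingularities.ResolutionOfSingularities.Theorems.WildQuotientsWildQuotientResolutionS1aOrbitRule

/-!
# S1a — THE CHARTWISE CUT OF THE AUX STUB: agreeing CENTRE charts over a top non-killable component glue to an AUX centre (`AuxChartsAt ⇒ AuxOrbitAt`)

[OURS · L1 W4.5c · lead-1 g9; the A-side twin of `…S1aKillCharts`] — NOT statements of the manuscript; counted 0; AI-level work, weaker than expert review.
Crux stmt-ResolutionOfSingularities-17941, line `s1a-logminvertex` v9, registered research stub `stub_auxWithinReach`. Route-independent.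

An `AuxOrbitAt` datum is ONE global admissible centre; the census recipes (recipe table v3/v3.1) are CHART data along a special line. This file separates the
GLUING (formal) from the RECIPE (research): finitely many CENTRE charts `(Oᵢ, 𝒦ᵢ)` (K1′-regular σ-adapted weighted centres, NOT required principal) of one
degree, AGREEING on overlaps, covering the closures of their supports, with supports inside the bad locus on the charts and containing a top non-killable
component, glue (`…S1aKillGlue.glue`) to an AUX centre `J` with `J|Oᵢ = 𝒦ᵢ|Oᵢ`; the killability clause is asked of EVERY `G`-stable filtration agreeing with
the charts (all of them have the same blow-up over `⋃ Oᵢ ⊇ supp`).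
* `actO_mem_of_isCentreChart(')`, `comap_restrict_aut_pullbackRees_of_isCentreChart` — `G`-stability of the restricted filtration on a CENTRE chart (the
  principal-chart lemmas of p611561 verbatim: stability is read off the σ-stable weighted filtration, not off the kill clause); `comap_aut_glue_of_isCentreChart`;
* ★★ `exists_isAuxCentre_of_charts` — the glued `J` is an AUX centre (admissible: centre charts `Oᵢ` over the support, idle node charts off it; principal-or-idle
  at GOOD points: the support lies in the bad locus), `J|Oᵢ = 𝒦ᵢ|Oᵢ`, `supp J_d ⊆ ⋃ closure (supp (𝒦ᵢ)_d ∩ Oᵢ)`, and `supp (𝒦ᵢ)_d ∩ Oᵢ ⊆ supp J_d`;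
* research def **`GameFrame.GModel.AuxChartsAt M`** and ★★ `auxOrbitAt_of_auxChartsAt`; `AuxChartsWithin n` (the bounded-sequence form with `AuxChartsAt` leaves)
  and `auxOrbitWithin_of_auxChartsWithin`; datum form `AuxChartsWithinReach p` and `auxWithinReach_of_auxChartsWithinReach` (`Or.inr`).
-/

set_option linter.dupNamespace false

noncomputable section

universe u

open CategoryTheory Limits AlgebraicGeometry TopologicalSpace Topology Opposite
open Literature.AlgebraicGeometry.Resolution Literature.AlgebraicGeometry.RelativeSpec
open Summit.ResolutionOfSingularities.ResolutionOfSingularities.Theorems.WildQuotientResolution.S1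
open Summit.ResolutionOfSingularities.ResolutionOfSingularities.Theorems.WildQuotientResolution.S1.NodeAtlas
open Summit.ResolutionOfSingularities.ResolutionOfSingularities.Theorems.WildQuotientResolution.S1.GoodCharts
open Summit.ResolutionOfSingularities.ResolutionOfSingularities.Theorems.WildQuotientResolution.S1.BlowupCharts
open Summit.ResolutionOfSingularities.ResolutionOfSingularities.Theorems.WildQuotientResolution.S1.CoarseChart
open Summit.ResolutionOfSingularities.ResolutionOfSingularities.Theorems.WildQuotientResolution.S1.KillableTransport
open Summit.ResolutionOfSingularities.ResolutionOfSingularities.Theorems.WildQuotientResolution.S1.ChartStable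
open Summit.ResolutionOfSingularities.ResolutionOfSingularities.Theorems.WildQuotientResolution.S1.CentreGluing
open Summit.ResolutionOfSingularities.ResolutionOfSingularities.Theorems.WildQuotientResolution.S1.ExtendRees
open Summit.ResolutionOfSingularities.ResolutionOfSingularities.Theorems.WildQuotientResolution.S1.KillFamily
open Summit.ResolutionOfSingularities.ResolutionOfSingularities.Theorems.WildQuotientResolution.S1.NodeChartAway
open Summit.ResolutionOfSingularities.ResolutionOfSingularities.Theorems.WildQuotientResolution.S1.KillGlue

namespace Summit.ResolutionOfSingularities.ResolutionOfSingularities.Theorems.WildQuotientResolution.S1.AuxCharts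

/-! ## `G`-stability of the restricted filtration on a CENTRE chart -/

section Stable

variable {V Y : Scheme.{u}} {q : V ⟶ Y} {G : Type u} [Group G] (ρ : ActionOver q G) (O : ρ.StableAffineOpens) {g₀ : G} {p : ℕ}

/-- On a centre chart the ideals `𝒦ₙ(O)` are `g₀`-stable (`e` intertwines `g₀` with `σ`; the weighted filtration is `σ`-stable). -/
theorem actO_mem_of_isCentreChart {𝒦 : ReesFiltration V} {d : ℕ} (hO : IsCentreChart p ρ g₀ 𝒦 d O) (hOaff : IsAffineOpen O.1) (n : ℕ) :
    ∀ t ∈ (𝒦.filtration ⟨O.1, hOaff⟩).ideal n, actO ρ O g₀ t ∈ (𝒦.filtration ⟨O.1, hOaff⟩).ideal n := by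
  obtain ⟨hOaff', m, r, B, _, 𝒜, _, σ, e, hnode, hσ, c, f, δ, w, -, -, -, -, -, hσJ, h𝒦, -⟩ := hO
  have hK : (𝒦.filtration ⟨O.1, hOaff⟩).ideal n = ((traceFiltration 𝒜 f w).ideal n).comap (e : Γ(V, O.1) →+* ↥(𝒜 0)) := h𝒦 n
  intro t ht
  rw [hK] at ht ⊢
  have ht' : ((e t : ↥(𝒜 0)) : B) ∈ (weightedFiltration f w).ideal n := ht
  change ((e (actO ρ O g₀ t) : ↥(𝒜 0)) : B) ∈ (weightedFiltration f w).ideal n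
  rw [hσ t]
  exact hσJ n (Ideal.mem_map_of_mem _ ht')

/-- … hence `g`-stable for every `g ∈ G = ⟨g₀⟩`. -/
theorem actO_mem_of_isCentreChart' [Finite G] (hG : ∀ g : G, g ∈ Subgroup.zpowers g₀) {𝒦 : ReesFiltration V} {d : ℕ}
    (hO : IsCentreChart p ρ g₀ 𝒦 d O) (hOaff : IsAffineOpen O.1) (n : ℕ) (g : G) :
    ∀ t ∈ (𝒦.filtration ⟨O.1, hOaff⟩).ideal n, actO ρ O g t ∈ (𝒦.filtration ⟨O.1, hOaff⟩).ideal n :=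
  actO_mem_of_generator ρ O hG (actO_mem_of_isCentreChart ρ O hO hOaff n) g

/-- **The restricted filtration on a CENTRE chart is `G`-stable** (proof of `comap_restrict_aut_pullbackRees`, p611561, with the centre-chart stability). -/
theorem comap_restrict_aut_pullbackRees_of_isCentreChart [Finite G] (hG : ∀ g : G, g ∈ Subgroup.zpowers g₀) {𝒦 : ReesFiltration V} {d : ℕ}
    (hO : IsCentreChart p ρ g₀ 𝒦 d O) (hOaff : IsAffineOpen O.1) (g : G) (n : ℕ) :
    ((pullbackRees 𝒦 O.1.ι).ideal n).comap ((ρ.restrict O.1 O.2.1).aut g).hom = (pullbackRees 𝒦 O.1.ι).ideal n := by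
  haveI : IsAffine (O.1 : Scheme.{u}) := hOaff
  apply Scheme.IdealSheafData.ext_of_isAffine
  let Otop : (O.1 : Scheme.{u}).affineOpens := ⟨⊤, isAffineOpen_top _⟩
  have h1 : (((pullbackRees 𝒦 O.1.ι).ideal n).comap ((ρ.restrict O.1 O.2.1).aut g).hom).ideal Otop =
      (((pullbackRees 𝒦 O.1.ι).ideal n).ideal Otop).map (((ρ.restrict O.1 O.2.1).aut g).hom.appLE ⊤ ⊤ le_top).hom :=
    ideal_comap_of_le ((ρ.restrict O.1 O.2.1).aut g).hom _ Otop Otop le_top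
  have h2 : ((pullbackRees 𝒦 O.1.ι).ideal n).ideal Otop =
      ((𝒦.filtration ⟨O.1, hOaff⟩).ideal n).map (O.1.ι.appLE O.1 ⊤ O.1.ι_preimage_self.ge).hom := by
    rw [pullbackRees_ideal, ReesFiltration.filtration_ideal]
    exact ideal_comap_of_le O.1.ι (𝒦.ideal n) ⟨O.1, hOaff⟩ Otop O.1.ι_preimage_self.ge
  change (((pullbackRees 𝒦 O.1.ι).ideal n).comap ((ρ.restrict O.1 O.2.1).aut g).hom).ideal Otop = ((pullbackRees 𝒦 O.1.ι).ideal n).ideal Otop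
  rw [h1, h2, Ideal.map_map]
  have hcomm : (((ρ.restrict O.1 O.2.1).aut g).hom.appLE ⊤ ⊤ le_top).hom.comp (O.1.ι.appLE O.1 ⊤ O.1.ι_preimage_self.ge).hom =
      (O.1.ι.appLE O.1 ⊤ O.1.ι_preimage_self.ge).hom.comp ((ρ.aut g).hom.appLE O.1 O.1 (O.2.1 g).ge).hom :=
    RingHom.ext fun t => appLE_restrict_top ρ O g t
  rw [hcomm, ← Ideal.map_map, appLE_aut_eq_actO_inv,
    map_actO_eq_of_stable ρ O (actO_mem_of_isCentreChart' ρ O hG hO hOaff n) g⁻¹]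

end Stable

/-! ## Gluing agreeing centre charts into an AUX centre -/

section Glue

variable {p : ℕ} {V Y : Scheme.{u}} {q : V ⟶ Y} {G : Type u} [Group G] (ρ : ActionOver q G) (g₀ : G)
variable [IsLocallyNoetherian V] {ι : Type} [Finite ι]

variable {ρ g₀} in
/-- The glued filtration of CENTRE charts is `G`-stable. [OURS · L1 W4.5c] -/
theorem comap_aut_glue_of_isCentreChart [Finite G] (hG : ∀ g : G, g ∈ Subgroup.zpowers g₀) (O : ι → ρ.StableAffineOpens)
    (𝒦 : ι → ReesFiltration V) {d : ℕ} (hc : ∀ i, IsCentreChart p ρ g₀ (𝒦 i) d (O i)) (g : G) (n : ℕ) :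
    ((glue ρ O 𝒦).ideal n).comap (ρ.aut g).hom = (glue ρ O 𝒦).ideal n := by
  refine comap_aut_infRees ρ _ (fun i g n => ?_) g n
  have hcomm : ∀ g : G, ((ρ.restrict (O i).1 (O i).2.1).aut g).hom ≫ (O i).1.ι = (O i).1.ι ≫ (ρ.aut g).hom := fun g => by
    rw [ActionOver.restrict_aut_hom, ActionOver.restrictHom_ι]
  exact comap_aut_pushforwardRees ρ (ρ.restrict (O i).1 (O i).2.1) (O i).1.ι hcomm (pullbackRees (𝒦 i) (O i).1.ι)
    (fun g n => comap_restrict_aut_pullbackRees_of_isCentreChart ρ (O i) hG (hc i) (hc i).1 g n) g n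

end Glue

/-! ## Model form -/

namespace Model

variable {p : ℕ} {X' X₁ : Scheme.{0}} {q : X' ⟶ X₁} {G : Type} [Group G] {ρ : G →* Aut X'} {g₀ : G}

/-- On a chart of the glued filtration, support membership is read off the chart filtration. -/
theorem mem_support_glue_iff (M : GameFrame.GModel p q G ρ g₀) [M.V.IsSeparated] {ι : Type} [Finite ι]
    (O : ι → M.act.StableAffineOpens) (𝒦 : ι → ReesFiltration M.V) (hO : ∀ i, IsAffineOpen (O i).1)
    (hagree : ∀ i k (U : M.V.affineOpens), U.1 ≤ (O i).1 → U.1 ≤ (O k).1 → ∀ n, ((𝒦 i).filtration U).ideal n = ((𝒦 k).filtration U).ideal n)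
    (i : ι) (d : ℕ) {v : M.V} (hv : v ∈ (O i).1) :
    v ∈ (((glue M.act O 𝒦).ideal d).support : Set M.V) ↔ v ∈ (((𝒦 i).ideal d).support : Set M.V) := by
  haveI : IsLocallyNoetherian M.V := M.isLocallyNoetherian
  have h := filtration_glue_eq O 𝒦 hO hagree i d
  rw [ReesFiltration.filtration_ideal, ReesFiltration.filtration_ideal] at h
  change v ∈ ((glue M.act O 𝒦).ideal d).support ↔ v ∈ ((𝒦 i).ideal d).support
  rw [Scheme.IdealSheafData.mem_support_iff_of_mem (U := ⟨(O i).1, hO i⟩) hv,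
    Scheme.IdealSheafData.mem_support_iff_of_mem (U := ⟨(O i).1, hO i⟩) hv, h]

/-- ★★ **AGREEING CENTRE CHARTS WITH BAD SUPPORTS GLUE TO AN AUX CENTRE.** On a model with separated underlying scheme (`G = ⟨g₀⟩` finite): finitely many
CENTRE charts `(Oᵢ, 𝒦ᵢ)` of one degree `d > 0`, agreeing on every affine open of each overlap, covering the closures of their supports, with
`supp (𝒦ᵢ)_d ∩ Oᵢ ⊆ Z(M)`, give an AUX centre `J` (admissible; principal-or-idle — indeed idle — at the good points) with `J|Oᵢ = 𝒦ᵢ|Oᵢ`,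
`supp J_d ⊆ ⋃ᵢ closure (supp (𝒦ᵢ)_d ∩ Oᵢ) ⊆ Z(M)` and `supp (𝒦ᵢ)_d ∩ Oᵢ ⊆ supp J_d`. [OURS · L1 W4.5c] -/
theorem exists_isAuxCentre_of_charts [Finite G] (hG : ∀ g : G, g ∈ Subgroup.zpowers g₀) (M : GameFrame.GModel p q G ρ g₀) [M.V.IsSeparated]
    {ι : Type} [Finite ι] (O : ι → M.act.StableAffineOpens) (𝒦 : ι → ReesFiltration M.V) {d : ℕ} (hd : 0 < d)
    (hc : ∀ i, IsCentreChart p M.act g₀ (𝒦 i) d (O i))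
    (hagree : ∀ i k (U : M.V.affineOpens), U.1 ≤ (O i).1 → U.1 ≤ (O k).1 → ∀ n, ((𝒦 i).filtration U).ideal n = ((𝒦 k).filtration U).ideal n)
    (hcl : ∀ i, closure ((((𝒦 i).ideal d).support : Set M.V) ∩ (O i).1) ⊆ ⋃ k, ((O k).1 : Set M.V))
    (hbad : ∀ i, (((𝒦 i).ideal d).support : Set M.V) ∩ (O i).1 ⊆ M.badLocus) :
    ∃ J : ReesFiltration M.V, IsAuxCentre p M.act g₀ J d (M.badLocus)ᶜ ∧
      (∀ (g : G) (n : ℕ), (J.ideal n).comap (M.act.aut g).hom = J.ideal n) ∧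
      (∀ i (hO : IsAffineOpen (O i).1) n, (J.filtration ⟨(O i).1, hO⟩).ideal n = ((𝒦 i).filtration ⟨(O i).1, hO⟩).ideal n) ∧
      (((J.ideal d).support : Set M.V) ⊆ ⋃ i, closure ((((𝒦 i).ideal d).support : Set M.V) ∩ (O i).1)) ∧
      ∀ i, (((𝒦 i).ideal d).support : Set M.V) ∩ (O i).1 ⊆ ((J.ideal d).support : Set M.V) := by
  haveI : IsLocallyNoetherian M.V := M.isLocallyNoetherian
  let J : ReesFiltration M.V := glue M.act O 𝒦
  have hJfil : ∀ i (hO : IsAffineOpen (O i).1) n, (J.filtration ⟨(O i).1, hO⟩).ideal n = ((𝒦 i).filtration ⟨(O i).1, hO⟩).ideal n :=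
    fun i hO n => filtration_glue_eq O 𝒦 (fun i => (hc i).1) hagree i n
  have hJO : ∀ i, IsCentreChart p M.act g₀ J d (O i) := fun i => isCentreChart_congr (hc i) fun hO n => hJfil i hO n
  have hGst : ∀ (g : G) (n : ℕ), (J.ideal n).comap (M.act.aut g).hom = J.ideal n := comap_aut_glue_of_isCentreChart hG O 𝒦 hc
  have hsub : ((J.ideal d).support : Set M.V) ⊆ ⋃ i, closure ((((𝒦 i).ideal d).support : Set M.V) ∩ (O i).1) :=
    support_glue_subset (ρ := M.act) O 𝒦 d
  have hcov : ((J.ideal d).support : Set M.V) ⊆ ⋃ k, ((O k).1 : Set M.V) := hsub.trans (Set.iUnion_subset fun i => hcl i)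
  have hsuppbad : ((J.ideal d).support : Set M.V) ⊆ M.badLocus :=
    hsub.trans (Set.iUnion_subset fun i => closure_minimal (hbad i) M.isClosed_badLocus)
  -- idle node charts off the support
  have hidle : ∀ v ∉ ((J.ideal d).support : Set M.V), ∃ O'' : M.act.StableAffineOpens, v ∈ O''.1 ∧ IsIdleChart p M.act g₀ J O'' := fun v hv => by
    obtain ⟨O₀, hvO₀, hn⟩ := M.atlas v
    obtain ⟨O'', hvO'', -, hO''W, hn''⟩ := exists_isNodeChart_le hn hvO₀ (J.ideal d).support.compl
      (preimage_support_compl M.act (fun g => hGst g d)) hv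
    refine ⟨O'', hvO'', hn'', fun n => filtration_eq_top_of_disjoint _ hd ⟨O''.1, hn''.1⟩ ?_ n⟩
    rw [Set.disjoint_left]
    intro x hx hx'
    exact hO''W hx hx'
  refine ⟨J, ⟨⟨hd, hGst, fun v => ?_⟩, fun v hv => ?_⟩, hGst, hJfil, hsub, fun i => ?_⟩
  · by_cases hv : v ∈ ((J.ideal d).support : Set M.V)
    · obtain ⟨i, hvi⟩ := Set.mem_iUnion.mp (hcov hv)
      exact ⟨O i, hvi, Or.inl (hJO i)⟩
    · obtain ⟨O'', hvO'', hI⟩ := hidle v hv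
      exact ⟨O'', hvO'', Or.inr hI⟩
  · -- good points are off the support
    have hv' : v ∉ ((J.ideal d).support : Set M.V) := fun h => hv (hsuppbad h)
    obtain ⟨O'', hvO'', hI⟩ := hidle v hv'
    exact ⟨O'', hvO'', Or.inr hI⟩
  · rintro v ⟨hvs, hvi⟩
    exact (mem_support_glue_iff M O 𝒦 (fun i => (hc i).1) hagree i d hvi).mpr hvs

/-- **`AuxChartsAt M`** (OURS CANDIDATE research statement, asserted nowhere; the CHARTWISE cut of `AuxOrbitAt`): finitely many CENTRE charts `(Oᵢ, 𝒦ᵢ)` of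
one degree `d > 0`, agreeing on every affine open of each overlap, covering the closures of their supports, with `supp (𝒦ᵢ)_d ∩ Oᵢ ⊆ Z(M)`, whose chart
supports contain SOME top-dimensional component of `nonKillable M`; and for EVERY `G`-stable filtration `J` agreeing with the charts whose support lies over
the charts, along every move of `(J, d)` every bad point over the support is KILLABLE (all such `J` have the same blow-up over `⋃ Oᵢ`; this is where the
census RECIPE — second-level kills on the charts of the weighted blow-up — enters). [OURS · L1 W4.5c] -/
def _root_.Summit.ResolutionOfSingularities.ResolutionOfSingularities.Theorems.WildQuotientResolution.S1.GameFrame.GModel.AuxChartsAt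
    (M : GameFrame.GModel p q G ρ g₀) : Prop :=
  ∃ (n : ℕ) (O : Fin n → M.act.StableAffineOpens) (𝒦 : Fin n → ReesFiltration M.V) (d : ℕ), 0 < d ∧
    (∀ i, IsCentreChart p M.act g₀ (𝒦 i) d (O i)) ∧
    (∀ i j (U : M.V.affineOpens), U.1 ≤ (O i).1 → U.1 ≤ (O j).1 → ∀ m, ((𝒦 i).filtration U).ideal m = ((𝒦 j).filtration U).ideal m) ∧
    (∀ i, closure ((((𝒦 i).ideal d).support : Set M.V) ∩ (O i).1) ⊆ ⋃ k, ((O k).1 : Set M.V)) ∧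
    (∀ i, (((𝒦 i).ideal d).support : Set M.V) ∩ (O i).1 ⊆ M.badLocus) ∧
    (∃ t ∈ irreducibleComponents ↥M.nonKillable, topologicalKrullDim ↥t = M.jInf ∧
      Subtype.val '' t ⊆ ⋃ i, ((((𝒦 i).ideal d).support : Set M.V) ∩ (O i).1)) ∧
    ∀ J : ReesFiltration M.V, (∀ (g : G) (m : ℕ), (J.ideal m).comap (M.act.aut g).hom = J.ideal m) →
      (∀ i (hO : IsAffineOpen (O i).1) m, (J.filtration ⟨(O i).1, hO⟩).ideal m = ((𝒦 i).filtration ⟨(O i).1, hO⟩).ideal m) →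
      (((J.ideal d).support : Set M.V) ⊆ ⋃ i, ((O i).1 : Set M.V)) →
      ∀ (M' : GameFrame.GModel p q G ρ g₀) (π' : M'.V ⟶ M.V), IsBlowup π' (J.ideal d) → M'.π = π' ≫ M.π → M'.r = π' ≫ M.r →
        (∀ g : G, (M'.act.aut g).hom ≫ π' = π' ≫ (M.act.aut g).hom) →
        ∀ v' ∈ M'.badLocus, π'.base v' ∈ ((J.ideal d).support : Set M.V) → M'.KillableAt v'

/-- ★★ **THE CHARTWISE CUT IMPLIES THE ONE-ORBIT AUX FORM**: `AuxChartsAt M ⇒ AuxOrbitAt M` (separated model, `G = ⟨g₀⟩` finite). [OURS · L1 W4.5c] -/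
theorem auxOrbitAt_of_auxChartsAt [Finite G] (hG : ∀ g : G, g ∈ Subgroup.zpowers g₀) (M : GameFrame.GModel p q G ρ g₀) [M.V.IsSeparated]
    (h : M.AuxChartsAt) : M.AuxOrbitAt := by
  obtain ⟨n, O, 𝒦, d, hd, hc, hagree, hcl, hbad, ⟨t, ht, hdt, htsupp⟩, hkill⟩ := h
  obtain ⟨J, haux, hGst, hJfil, hsub, hsup⟩ := exists_isAuxCentre_of_charts hG M O 𝒦 hd hc hagree hcl hbad
  have hcov : ((J.ideal d).support : Set M.V) ⊆ ⋃ k, ((O k).1 : Set M.V) := hsub.trans (Set.iUnion_subset fun i => hcl i)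
  refine ⟨J, d, haux, ⟨t, ht, hdt, htsupp.trans (Set.iUnion_subset fun i => hsup i)⟩, fun M' π' hbl hπ hr hcomm v' hv' hvs => ?_⟩
  exact hkill J hGst hJfil hcov M' π' hbl hπ hr hcomm v' hv' hvs

/-- **`AuxChartsWithin n M`**: the bounded-sequence recursion of `AuxOrbitWithin` with `AuxChartsAt` leaves. [OURS · L1 W4.5c · CANDIDATE] -/
def _root_.Summit.ResolutionOfSingularities.ResolutionOfSingularities.Theorems.WildQuotientResolution.S1.GameFrame.GModel.AuxChartsWithin :
    ℕ → GameFrame.GModel p q G ρ g₀ → Prop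
  | 0, M => M.AuxChartsAt
  | n + 1, M => M.AuxChartsAt ∨
      ∃ (𝒦 : ReesFiltration M.V) (d : ℕ), IsAuxCentre p M.act g₀ 𝒦 d (M.badLocus)ᶜ ∧
        ∀ M' : GameFrame.GModel p q G ρ g₀, M.IsMoveOf M' 𝒦 d →
          (M'.jInf < M.jInf ∨ (M'.jInf = M.jInf ∧ M'.topCount ≤ M.topCount)) ∧ GameFrame.GModel.AuxChartsWithin n M'

/-- `AuxChartsWithin n ⇒ AuxOrbitWithin n` on separated models (the datumʼs models are separated, `isSeparated_of_datum`). [OURS · L1 W4.5c] -/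
theorem auxOrbitWithin_of_auxChartsWithin [Finite G] (hG : ∀ g : G, g ∈ Subgroup.zpowers g₀)
    (hsep : ∀ M : GameFrame.GModel p q G ρ g₀, M.V.IsSeparated) :
    ∀ (n : ℕ) (M : GameFrame.GModel p q G ρ g₀), M.AuxChartsWithin n → GameFrame.GModel.AuxOrbitWithin n M
  | 0, M, h => by haveI := hsep M; exact auxOrbitAt_of_auxChartsAt hG M h
  | n + 1, M, h => by
      haveI := hsep M
      rcases h with h | ⟨𝒦, d, haux, hmv⟩
      · exact Or.inl (auxOrbitAt_of_auxChartsAt hG M h)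
      · exact Or.inr ⟨𝒦, d, haux, fun M' hm => ⟨(hmv M' hm).1, auxOrbitWithin_of_auxChartsWithin hG hsep n M' (hmv M' hm).2⟩⟩

end Model

/-! ## Datum form -/

/-- **`AuxChartsWithinReach p`** (OURS CANDIDATE research statement, asserted nowhere): at every reachable non-terminal model with `jInf ≠ ⊥`,
`∃ n, AuxChartsWithin n M` — the one-orbit aux sequence whose final step is given by CHART data (agreeing centre charts over a top non-killable component +
killability of every agreeing extensionʼs moves). Implies the orbit disjunct of the registered `AuxWithinReach p`. [OURS · L1 W4.5c] -/
def AuxChartsWithinReach (p : ℕ) : Prop :=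
  ∀ (k : Type) [Field k] [CharP k p] [PerfectField k] (X' X₁ : Scheme.{0})
    (f : X₁ ⟶ Spec (.of k)) (q : X' ⟶ X₁) (G : Type) [Group G] [Finite G]
    (ρ : G →* Aut X'), Nat.card G = p → IsSeparated f → LocallyOfFiniteType f → QuasiCompact f →
    IsIntegral X₁ → ∀ [IsIntegral X'], Scheme.IsRegular X' → IsFinite q → Function.Surjective q.base →
    (∃ U : X₁.Opens, Dense (U : Set X₁) ∧ Etale (q ∣_ U)) →
    ∀ (hq : ∀ g : G, (ρ g).hom ≫ q = q),
    (∀ x y : X', q.base x = q.base y → ∃ g : G, (ρ g).hom.base x = y) →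
    topologicalKrullDim X₁ ≤ 4 → Function.Injective ρ →
    ∀ (g₀ : G), (∀ g : G, g ∈ Subgroup.zpowers g₀) → ∀ [IsLocallyNoetherian X']
      (h₀ : NodeAtlas p (⟨ρ, hq⟩ : ActionOver q G) g₀),
      ∀ M : GameFrame.GModel p q G ρ g₀, (GameFrame.GModel.initial hq h₀).Reachable M → ¬ M.Terminal →
        M.jInf ≠ ⊥ → ∃ n : ℕ, M.AuxChartsWithin n

/-- ★ **The chartwise A-cut implies the registered A stub**: `AuxChartsWithinReach p ⇒ AuxWithinReach p` (`Or.inr`). [OURS · L1 W4.5c] -/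
theorem auxWithinReach_of_auxChartsWithinReach {p : ℕ} (h : AuxChartsWithinReach p) : AuxWithinReach p := by
  intro k _ _ _ X' X₁ f q G _ _ ρ hG hfs hfft hfqc hX₁ _ hreg hqfin hqs hqet hq horb hdim hinj g₀ hg₀ _ h₀ M hR hT hj
  haveI := hfs
  haveI := hqfin
  obtain ⟨n, hn⟩ := h k X' X₁ f q G ρ hG hfs hfft hfqc hX₁ hreg hqfin hqs hqet hq horb hdim hinj g₀ hg₀ h₀ M hR hT hj
  exact Or.inr ⟨n, Model.auxOrbitWithin_of_auxChartsWithin hg₀ (fun M => isSeparated_of_datum f M) n M hn⟩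

end Summit.ResolutionOfSingularities.ResolutionOfSingularities.Theorems.WildQuotientResolution.S1.AuxCharts

end
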